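import Mathlib.Analysis.Normed.Field.Basic
import Mathlib.Analysis.Normed.Module.FiniteDimension
import Mathlib.Topology.Algebra.Polynomial
import Mathlib.Algebra.Polynomial.Roots
import Literature.LinearAlgebra.Matrix.CharpolyLocalRigidity     -- ★ divided differences `aeval_sub_aeval_eq_dividedDiff_mul`, `dividedDiff_self`, `isUnit_aeval_derivative_of_separable`
import Literature.NumberTheory.LocalFields.KrasnerLocallyConstant  -- ★ root calculus over a normed field: `norm_multiset_prod`, `pow_card_le_multiset_prod` (reused, not restated)
import HarnessLib

/-!
# F0 · P3c · line LH6 «StCharTS» — «ROOT-CALCULUS★»: rational roots of nearby polynomials over a PROPER normed field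
# (the field-level core of «ELL-OPEN★» `F0P3cStCharTSEllOpen`: datum road MAP-DATUM-ROAD v1∕v2, slice S8 part 1)

Cell `pub/hodgecm-mathlib`, crux H413 = `stmt-HodgeConjecture-24833` (lane `--supports … --as helper`), route HCCMUnconditional; seat F0P2-p06 (g17).
THEOREMS ONLY over Mathlib + ★ `Literature.LinearAlgebra.Matrix.CharpolyLocalRigidity` + ★ `Literature.NumberTheory.LocalFields.KrasnerLocallyConstant` (no definition ∕ instance ∕ notation ∕ named fact ∕ `sorry`);
nothing here mentions `U(3)` — the consumer is ★-candidate `Theorems/F0P3cStCharTSEllOpen.lean` («`G^e = G^r ∖ Ω` is open»).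

THE MATHEMATICS (eigenvalues only — no Krasner, no Hensel, no extension of the absolute value).  `K` a normed field.
* §1 Cauchy's bound `norm_root_le_max_one_sum`: a root `r` of a MONIC `p` has `‖r‖ ≤ max 1 (∑_{i<n} ‖aᵢ‖)`; the perturbation estimate
  `norm_eval_sub_eval_le`; `‖p(x)‖ = ∏ ‖x − a‖ · ‖q(x)‖` for `p = ∏ (X − a) · q`.
* §2 (`K` PROPER) `exists_forall_root_near`: for a monic `p₀` and `η > 0` there is `ε > 0` such that every `K`-root of a monic `p` of the same degree with
  coefficients within `ε` lies within `η` of a `K`-root of `p₀` — write `p₀ = ∏_{a ∈ roots} (X − a) · q₀` with `q₀` root-free (Mathlib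
  `exists_prod_multiset_X_sub_C_mul`); `q₀` is bounded below by some `δ > 0` on the compact ball containing all roots (`exists_pos_le_norm_eval_of_roots_eq_zero`),
  and `‖p₀(r)‖ = ‖p₀(r) − p(r)‖` is small.
* §3 (any `K`) `exists_root_unique_near`: if `p₀′(a) ≠ 0` then nearby polynomials have AT MOST ONE root near `a` — `p(y) − p(x) = D(p; x, y)(y − x)` with the
  divided difference `D` continuous in `(p, x, y)` and `D(p₀; a, a) = p₀′(a) ≠ 0` (★ `CharpolyLocalRigidity`).
* §4 THE CORE LEMMA `eq_of_roots_of_map_mul_eq_one`: `σ : K →+* K` continuous, `p₀` monic separable with every `K`-root on the «norm-one torus»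
  `a σ(a) = 1`; then for some `ε > 0` no monic `p` of the same degree with coefficients within `ε` has two DISTINCT `K`-roots `α ≠ β` with `σ(α) β = 1`
  (`α` is near a root `a`, hence `β = σ(α)⁻¹` is near `σ(a)⁻¹ = a`, and §3).
HONEST LABEL: HC_CM is proved only modulo the 7 printed citations (2 remaining named inputs: hLiu418 = `stmt-HodgeConjecture-24832`, h413 =
`stmt-HodgeConjecture-24833`) until rung 0 closes; this file closes no organ (count-neutral datum-road brick).

## References
* [Gouvea1993PadicNumbers] F. Q. Gouvêa, *p-adic Numbers*, Universitext (1993∕1997), §6.8 (continuity of roots, Problem 282; Cor. 6.8.3).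
* [Borel1991] A. Borel, *Linear Algebraic Groups*, 2nd ed. (1991), IV.12.2–12.3 (regular semisimple elements; the divided-difference argument).
* [Rogawski1990] J. D. Rogawski, *Automorphic Representations of Unitary Groups in Three Variables*, Ann. of Math. Stud. 123 (1990), §12.5 pp. 182–184.
-/

set_option autoImplicit false
-- the mandated namespace has the single-problem summit's repeated segment (`HodgeConjecture.HodgeConjecture`)
set_option linter.dupNamespace false

noncomputable section

open Polynomial Filter Topology Metric
open Literature.NumberTheory.LocalFields (norm_multiset_prod pow_card_le_multiset_prod)

namespace Summit.HodgeConjecture.HodgeConjecture.Cruxes.H413.F0P3cStCharTSRootCalculus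

/-! ## §1 Root calculus over a normed field -/

section RootCalculus

variable {K : Type*} [NormedField K]

/-- Cauchy's bound: a root `r` of a MONIC polynomial `p` of degree `n` has `‖r‖ ≤ max 1 (∑_{i<n} ‖p.coeff i‖)`. [folklore] -/
theorem norm_root_le_max_one_sum {p : K[X]} (hp : p.Monic) {r : K} (hr : p.IsRoot r) :
    ‖r‖ ≤ max 1 (∑ i ∈ Finset.range p.natDegree, ‖p.coeff i‖) := by
  by_contra h
  rw [not_le, max_lt_iff] at h
  obtain ⟨h1, hS⟩ := h
  set n := p.natDegree with hn
  set S := ∑ i ∈ Finset.range n, ‖p.coeff i‖ with hS'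
  -- `r ^ n = -(∑_{i<n} a_i r^i)`
  have heval : p.eval r = ∑ i ∈ Finset.range (n + 1), p.coeff i * r ^ i :=
    eval_eq_sum_range' (Nat.lt_succ_self _) r
  have hlead : p.coeff n = 1 := by rw [hn]; exact hp.coeff_natDegree
  rw [hr.eq_zero, Finset.sum_range_succ, hlead, one_mul] at heval
  have hrn : r ^ n = -∑ i ∈ Finset.range n, p.coeff i * r ^ i := by
    rw [eq_neg_iff_add_eq_zero, add_comm]; exact heval.symm
  -- norms: `‖r‖^n ≤ S ‖r‖^(n-1)`
  have hr0 : 0 < ‖r‖ := lt_trans one_pos h1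
  have hn0 : n ≠ 0 := by
    intro h0
    rw [h0, Finset.sum_range_zero, pow_zero, zero_add] at heval
    exact one_ne_zero heval.symm
  have hle : ‖r‖ ^ n ≤ S * ‖r‖ ^ (n - 1) := by
    calc ‖r‖ ^ n = ‖r ^ n‖ := (norm_pow r n).symm
      _ = ‖∑ i ∈ Finset.range n, p.coeff i * r ^ i‖ := by rw [hrn, norm_neg]
      _ ≤ ∑ i ∈ Finset.range n, ‖p.coeff i * r ^ i‖ := norm_sum_le _ _
      _ ≤ ∑ i ∈ Finset.range n, ‖p.coeff i‖ * ‖r‖ ^ (n - 1) := by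
          refine Finset.sum_le_sum fun i hi => ?_
          rw [norm_mul, norm_pow]
          refine mul_le_mul_of_nonneg_left ?_ (norm_nonneg _)
          exact pow_le_pow_right₀ h1.le (by have := Finset.mem_range.1 hi; omega)
      _ = S * ‖r‖ ^ (n - 1) := by rw [Finset.sum_mul]
  -- divide by `‖r‖^(n-1) > 0`
  have hpow : 0 < ‖r‖ ^ (n - 1) := pow_pos hr0 _
  have : ‖r‖ ≤ S := by
    have h2 : ‖r‖ ^ n = ‖r‖ * ‖r‖ ^ (n - 1) := by
      rw [← pow_succ', Nat.sub_add_cancel (Nat.one_le_iff_ne_zero.2 hn0)]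
    rw [h2] at hle
    exact le_of_mul_le_mul_right hle hpow
  exact (not_lt.2 this) hS

/-- Perturbation estimate: if `‖r‖ ≤ C`, `1 ≤ C`, both polynomials have `natDegree < N` and coefficients within `ε`, then
`‖p₀.eval r - p.eval r‖ ≤ N * ε * C ^ (N - 1)`. [folklore] -/
theorem norm_eval_sub_eval_le {p₀ p : K[X]} {N : ℕ} (h₀ : p₀.natDegree < N) (h : p.natDegree < N) {ε : ℝ} (hε : 0 ≤ ε)
    (hcoeff : ∀ i, ‖p.coeff i - p₀.coeff i‖ ≤ ε) {C : ℝ} (hC : 1 ≤ C) {r : K} (hr : ‖r‖ ≤ C) :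
    ‖p₀.eval r - p.eval r‖ ≤ N * ε * C ^ (N - 1) := by
  have hdeg : (p₀ - p).natDegree < N := lt_of_le_of_lt (natDegree_sub_le _ _) (max_lt h₀ h)
  rw [← eval_sub, eval_eq_sum_range' hdeg]
  calc ‖∑ i ∈ Finset.range N, (p₀ - p).coeff i * r ^ i‖
      ≤ ∑ i ∈ Finset.range N, ‖(p₀ - p).coeff i * r ^ i‖ := norm_sum_le _ _
    _ ≤ ∑ _i ∈ Finset.range N, ε * C ^ (N - 1) := by
        refine Finset.sum_le_sum fun i hi => ?_
        rw [norm_mul, norm_pow, coeff_sub, ← norm_neg, neg_sub]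
        refine mul_le_mul (hcoeff i) ?_ (pow_nonneg (norm_nonneg _) _) hε
        exact le_trans (pow_le_pow_left₀ (norm_nonneg _) hr i) (pow_le_pow_right₀ hC (by have := Finset.mem_range.1 hi; omega))
    _ = N * ε * C ^ (N - 1) := by rw [Finset.sum_const, Finset.card_range, nsmul_eq_mul, mul_assoc]

/-- `‖p.eval x‖` for `p = (∏_{a ∈ m} (X - C a)) * q`: `= (∏_{a ∈ m} ‖x - a‖) * ‖q.eval x‖`. [folklore] -/
theorem norm_eval_prod_X_sub_C_mul (m : Multiset K) (q : K[X]) (x : K) :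
    ‖((m.map fun a => X - C a).prod * q).eval x‖ = (m.map fun a => ‖x - a‖).prod * ‖q.eval x‖ := by
  rw [eval_mul, norm_mul, eval_multiset_prod, norm_multiset_prod, Multiset.map_map, Multiset.map_map]
  congr 2
  refine Multiset.map_congr rfl fun a _ => ?_
  simp

end RootCalculus

/-! ## §2 Roots of nearby polynomials stay near the old rational roots (proper normed field) -/

section RootsNear

variable {K : Type*} [NormedField K] [ProperSpace K]

/-- A nonzero polynomial WITHOUT roots is bounded below on every closed ball. [folklore] -/
theorem exists_pos_le_norm_eval_of_roots_eq_zero {q : K[X]} (hq : q ≠ 0) (hroots : q.roots = 0) (C : ℝ) :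
    ∃ δ : ℝ, 0 < δ ∧ ∀ x ∈ closedBall (0 : K) C, δ ≤ ‖q.eval x‖ := by
  by_cases hC : C < 0
  · refine ⟨1, one_pos, fun x hx => ?_⟩
    exact absurd (lt_of_le_of_lt (mem_closedBall.1 hx) hC) (not_lt.2 dist_nonneg)
  rw [not_lt] at hC
  have hne : (closedBall (0 : K) C).Nonempty := ⟨0, mem_closedBall_self hC⟩
  obtain ⟨x₀, hx₀, hmin⟩ := (isCompact_closedBall (0 : K) C).exists_isMinOn hne (q.continuous.norm.continuousOn)
  refine ⟨‖q.eval x₀‖, ?_, fun x hx => hmin hx⟩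
  rw [norm_pos_iff]
  intro h0
  have : x₀ ∈ q.roots := (mem_roots hq).2 h0
  rw [hroots] at this
  exact Multiset.notMem_zero _ this

/-- **Roots stay near the old rational roots.**  For a monic `p₀` and `η > 0` there is `ε > 0` such that every root `r ∈ K` of a monic `p` of the same
degree with coefficients within `ε` of those of `p₀` lies within `η` of some root of `p₀` in `K` (in particular `p` has no root in `K` if `p₀` has none). [folklore] -/
theorem exists_forall_root_near (p₀ : K[X]) (hp₀ : p₀.Monic) {η : ℝ} (hη : 0 < η) :
    ∃ ε : ℝ, 0 < ε ∧ ∀ p : K[X], p.Monic → p.natDegree = p₀.natDegree → (∀ i, ‖p.coeff i - p₀.coeff i‖ < ε) →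
      ∀ r : K, p.IsRoot r → ∃ a ∈ p₀.roots, ‖r - a‖ < η := by
  set n := p₀.natDegree with hn
  -- the bound `C` on roots of nearby monic polynomials
  set C : ℝ := 1 + ∑ i ∈ Finset.range n, ‖p₀.coeff i‖ + n with hC
  have hS0 : 0 ≤ ∑ i ∈ Finset.range n, ‖p₀.coeff i‖ := Finset.sum_nonneg fun _ _ => norm_nonneg _
  have hC1 : 1 ≤ C := by rw [hC]; have : (0 : ℝ) ≤ n := Nat.cast_nonneg n; linarith
  -- the root-free factor `q₀` of `p₀` and its lower bound `δ` on the ball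
  obtain ⟨q₀, hq₀, -, hq₀roots⟩ := exists_prod_multiset_X_sub_C_mul p₀
  have hq₀ne : q₀ ≠ 0 := by
    intro h; rw [h, mul_zero] at hq₀; exact hp₀.ne_zero hq₀.symm
  obtain ⟨δ, hδ, hδle⟩ := exists_pos_le_norm_eval_of_roots_eq_zero hq₀ne hq₀roots C
  set k := Multiset.card p₀.roots with hk
  -- choose `ε`
  have hNC : 0 < (n + 1 : ℝ) * C ^ n := mul_pos (by positivity) (pow_pos (lt_of_lt_of_le one_pos hC1) _)
  refine ⟨min 1 (η ^ k * δ / (2 * ((n + 1 : ℝ) * C ^ n))), lt_min one_pos (div_pos (mul_pos (pow_pos hη _) hδ) (by positivity)), ?_⟩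
  intro p hp hdeg hcoeff r hr
  have hε1 : ∀ i, ‖p.coeff i - p₀.coeff i‖ ≤ 1 := fun i => ((hcoeff i).trans_le (min_le_left _ _)).le
  have hε2 : ∀ i, ‖p.coeff i - p₀.coeff i‖ ≤ η ^ k * δ / (2 * ((n + 1 : ℝ) * C ^ n)) :=
    fun i => ((hcoeff i).trans_le (min_le_right _ _)).le
  -- `‖r‖ ≤ C`
  have hrC : ‖r‖ ≤ C := by
    refine (norm_root_le_max_one_sum hp hr).trans (max_le hC1 ?_)
    rw [hdeg]
    calc ∑ i ∈ Finset.range n, ‖p.coeff i‖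
        ≤ ∑ i ∈ Finset.range n, (‖p₀.coeff i‖ + 1) := by
          refine Finset.sum_le_sum fun i _ => ?_
          calc ‖p.coeff i‖ = ‖p₀.coeff i + (p.coeff i - p₀.coeff i)‖ := by rw [add_sub_cancel]
            _ ≤ ‖p₀.coeff i‖ + ‖p.coeff i - p₀.coeff i‖ := norm_add_le _ _
            _ ≤ ‖p₀.coeff i‖ + 1 := by linarith [hε1 i]
      _ = ∑ i ∈ Finset.range n, ‖p₀.coeff i‖ + n := by
          rw [Finset.sum_add_distrib, Finset.sum_const, Finset.card_range, nsmul_eq_mul, mul_one]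
      _ ≤ C := by rw [hC]; linarith
  -- `‖p₀.eval r‖` is small
  have hsmall : ‖p₀.eval r‖ ≤ (n + 1 : ℝ) * (η ^ k * δ / (2 * ((n + 1 : ℝ) * C ^ n))) * C ^ n := by
    have h := norm_eval_sub_eval_le (N := n + 1) (p₀ := p₀) (p := p) (by omega) (by omega)
      (le_of_lt (div_pos (mul_pos (pow_pos hη _) hδ) (by positivity))) hε2 hC1 hrC
    rw [hr.eq_zero, sub_zero, Nat.add_sub_cancel] at h
    exact_mod_cast h
  have hsmall' : ‖p₀.eval r‖ ≤ η ^ k * δ / 2 := by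
    refine hsmall.trans (le_of_eq ?_)
    field_simp
  -- `‖p₀.eval r‖` is the product over the roots times `‖q₀.eval r‖ ≥ δ`
  have hprod : ‖p₀.eval r‖ = (p₀.roots.map fun a => ‖r - a‖).prod * ‖q₀.eval r‖ := by
    conv_lhs => rw [← hq₀]
    exact norm_eval_prod_X_sub_C_mul _ _ _
  -- if `r` were `η`-far from every root, the product would be `≥ η ^ k`
  by_contra hfar
  push Not at hfar
  have hk' : Multiset.card (p₀.roots.map fun a => ‖r - a‖) = k := by rw [Multiset.card_map]
  have hge : η ^ k ≤ (p₀.roots.map fun a => ‖r - a‖).prod := by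
    rw [← hk']
    refine pow_card_le_multiset_prod hη.le fun x hx => ?_
    obtain ⟨a, ha, rfl⟩ := Multiset.mem_map.1 hx
    exact hfar a ha
  have hqr : δ ≤ ‖q₀.eval r‖ := hδle r (mem_closedBall_zero_iff.2 hrC)
  have : η ^ k * δ ≤ ‖p₀.eval r‖ := by
    rw [hprod]
    exact mul_le_mul hge hqr hδ.le (le_trans (pow_nonneg hη.le _) hge)
  have hpos : 0 < η ^ k * δ := mul_pos (pow_pos hη _) hδ
  linarith

end RootsNear

/-! ## §3 At most ONE root near a simple root (any normed field): the divided difference does not vanish -/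

section OneRoot

variable {K : Type*} [NormedField K]

/-- The divided difference `D_N(c; x, y) = ∑_{k<N} c_k ∑_{j<k} y^j x^{k-1-j}` as a continuous function of `(c, x, y)`. [folklore] -/
theorem continuous_dividedDiff (N : ℕ) :
    Continuous fun z : (Fin N → K) × (K × K) => ∑ k : Fin N, z.1 k * ∑ j ∈ Finset.range k, z.2.2 ^ j * z.2.1 ^ ((k : ℕ) - 1 - j) := by
  refine continuous_finsetSum _ fun k _ => ((continuous_apply k).comp continuous_fst).mul ?_
  refine continuous_finsetSum _ fun j _ => ?_
  exact ((continuous_snd.comp continuous_snd).pow j).mul ((continuous_fst.comp continuous_snd).pow _)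

/-- The divided difference at `(coeff p, x, y)` in the `Finset.range` form of ★ `aeval_sub_aeval_eq_dividedDiff_mul`. [folklore] -/
theorem dividedDiff_eq_sum_range (N : ℕ) (p : K[X]) (x y : K) :
    (∑ k : Fin N, (fun i : Fin N => p.coeff i) k * ∑ j ∈ Finset.range k, y ^ j * x ^ ((k : ℕ) - 1 - j)) =
      ∑ k ∈ Finset.range N, p.coeff k • ∑ j ∈ Finset.range k, y ^ j * x ^ (k - 1 - j) := by
  rw [Fin.sum_univ_eq_sum_range (fun k => p.coeff k * ∑ j ∈ Finset.range k, y ^ j * x ^ (k - 1 - j)) N]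
  simp only [smul_eq_mul]

/-- **At most one root near a simple root.**  If `p₀'(a) ≠ 0` then for some `ρ > 0`: every polynomial `p` with `natDegree < N` and coefficients within `ρ`
of those of `p₀` has at most one root in the ball `B(a, ρ)` (`p(r₂) - p(r₁) = D · (r₂ - r₁)` with `D` near `p₀'(a) ≠ 0`). [folklore] -/
theorem exists_root_unique_near {p₀ : K[X]} {N : ℕ} (h₀ : p₀.natDegree < N) {a : K} (ha : (derivative p₀).eval a ≠ 0) :
    ∃ ρ : ℝ, 0 < ρ ∧ ∀ p : K[X], p.natDegree < N → (∀ i, ‖p.coeff i - p₀.coeff i‖ < ρ) →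
      ∀ r₁ r₂ : K, p.IsRoot r₁ → p.IsRoot r₂ → ‖r₁ - a‖ < ρ → ‖r₂ - a‖ < ρ → r₁ = r₂ := by
  set Φ : (Fin N → K) × (K × K) → K :=
    fun z => ∑ k : Fin N, z.1 k * ∑ j ∈ Finset.range k, z.2.2 ^ j * z.2.1 ^ ((k : ℕ) - 1 - j) with hΦ
  set z₀ : (Fin N → K) × (K × K) := (fun i : Fin N => p₀.coeff i, (a, a)) with hz₀
  have hΦz₀ : Φ z₀ = (derivative p₀).eval a := by
    rw [hΦ, hz₀]
    dsimp only
    rw [dividedDiff_eq_sum_range N p₀ a a, Literature.LinearAlgebra.Matrix.dividedDiff_self p₀ h₀ a, coe_aeval_eq_eval]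
  have hU : IsOpen (Φ ⁻¹' {0}ᶜ) := isOpen_compl_singleton.preimage (continuous_dividedDiff N)
  have hz₀U : z₀ ∈ Φ ⁻¹' {0}ᶜ := by
    rw [Set.mem_preimage, Set.mem_compl_singleton_iff, hΦz₀]; exact ha
  obtain ⟨ρ, hρ, hball⟩ := Metric.isOpen_iff.1 hU z₀ hz₀U
  refine ⟨ρ, hρ, fun p hp hcoeff r₁ r₂ h₁ h₂ hr₁ hr₂ => ?_⟩
  set z : (Fin N → K) × (K × K) := (fun i : Fin N => p.coeff i, (r₁, r₂)) with hz
  have hzball : z ∈ ball z₀ ρ := by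
    rw [mem_ball, Prod.dist_eq, max_lt_iff, Prod.dist_eq, max_lt_iff, dist_pi_lt_iff hρ]
    refine ⟨fun i => ?_, ?_, ?_⟩
    · rw [dist_eq_norm]; exact hcoeff i
    · rw [dist_eq_norm]; exact hr₁
    · rw [dist_eq_norm]; exact hr₂
  have hD : Φ z ≠ 0 := hball hzball
  have hid := Literature.LinearAlgebra.Matrix.aeval_sub_aeval_eq_dividedDiff_mul p hp (Commute.all r₁ r₂)
  rw [coe_aeval_eq_eval, coe_aeval_eq_eval, h₁.eq_zero, h₂.eq_zero, sub_zero, ← dividedDiff_eq_sum_range N p r₁ r₂] at hid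
  have hD' : Φ z * (r₂ - r₁) = 0 := by rw [hΦ, hz]; exact hid.symm
  rcases mul_eq_zero.1 hD' with h | h
  · exact absurd h hD
  · exact (sub_eq_zero.1 h).symm

end OneRoot

/-! ## §4 The core: near a separable monic `p₀` all of whose rational roots lie on `{a σ(a) = 1}`, no polynomial has two distinct rational roots
`α ≠ β` with `σ(α) β = 1` -/

section Core

variable {K : Type*} [NormedField K] [ProperSpace K]

/-- A finite family of positive reals indexed by a finset has a common positive lower bound `≤ 1`. [folklore] -/
theorem exists_pos_le_forall_of_finset {ι : Type*} (T : Finset ι) (ρ : ι → ℝ) (hρ : ∀ a ∈ T, 0 < ρ a) :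
    ∃ ρ₀ : ℝ, 0 < ρ₀ ∧ ρ₀ ≤ 1 ∧ ∀ a ∈ T, ρ₀ ≤ ρ a := by
  classical
  refine ⟨(insert 1 (T.image ρ)).min' (Finset.insert_nonempty _ _), ?_, Finset.min'_le _ _ (Finset.mem_insert_self _ _), fun a ha => Finset.min'_le _ _ (Finset.mem_insert_of_mem (Finset.mem_image_of_mem ρ ha))⟩
  rw [Finset.lt_min'_iff]
  intro y hy
  rcases Finset.mem_insert.1 hy with rfl | hy
  · exact one_pos
  · obtain ⟨a, ha, rfl⟩ := Finset.mem_image.1 hy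
    exact hρ a ha

/-- **THE CORE LEMMA.**  `K` a proper normed field, `σ : K →+* K` continuous, `p₀ ∈ K[X]` monic and separable with every root `a ∈ K` on the
«norm-one torus» `a σ(a) = 1`.  Then for some `ε > 0`, NO monic `p` of the same degree with coefficients within `ε` of those of `p₀` has two DISTINCT
roots `α ≠ β` in `K` with `σ(α) β = 1`: by §2 `α` is near a root `a` of `p₀`, so `β = σ(α)⁻¹` is near `σ(a)⁻¹ = a` as well, and by §3 two roots of
`p` near the simple root `a` coincide. [folklore] -/
theorem eq_of_roots_of_map_mul_eq_one (σ : K →+* K) (hσ : Continuous σ) {p₀ : K[X]} (hp₀ : p₀.Monic) (hsep : p₀.Separable)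
    (hN : ∀ a : K, p₀.IsRoot a → a * σ a = 1) :
    ∃ ε : ℝ, 0 < ε ∧ ∀ p : K[X], p.Monic → p.natDegree = p₀.natDegree → (∀ i, ‖p.coeff i - p₀.coeff i‖ < ε) →
      ∀ α β : K, p.IsRoot α → p.IsRoot β → σ α * β = 1 → α = β := by
  classical
  set n := p₀.natDegree with hn
  set T : Finset K := p₀.roots.toFinset with hT
  have hTroot : ∀ a ∈ T, p₀.IsRoot a := fun a ha => (mem_roots hp₀.ne_zero).1 (Multiset.mem_toFinset.1 ha)
  -- §3 at every root: simple roots (separability)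
  have hder : ∀ a ∈ T, (derivative p₀).eval a ≠ 0 := fun a ha => by
    have hu := Literature.LinearAlgebra.Matrix.isUnit_aeval_derivative_of_separable (A := K) hsep (x := a)
      (by rw [coe_aeval_eq_eval]; exact (hTroot a ha).eq_zero)
    rw [coe_aeval_eq_eval] at hu
    exact hu.ne_zero
  have hB : ∀ a ∈ T, ∃ ρ : ℝ, 0 < ρ ∧ ∀ p : K[X], p.natDegree < n + 1 → (∀ i, ‖p.coeff i - p₀.coeff i‖ < ρ) →
      ∀ r₁ r₂ : K, p.IsRoot r₁ → p.IsRoot r₂ → ‖r₁ - a‖ < ρ → ‖r₂ - a‖ < ρ → r₁ = r₂ :=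
    fun a ha => exists_root_unique_near (N := n + 1) (by omega) (hder a ha)
  choose! ρ hρpos hρB using hB
  obtain ⟨ρ₀, hρ₀, -, hρ₀le⟩ := exists_pos_le_forall_of_finset T ρ hρpos
  -- continuity of `y ↦ σ(y)⁻¹` at every root `a` (where `σ(a)⁻¹ = a`)
  have hσa : ∀ a ∈ T, σ a ≠ 0 := fun a ha h => by
    have := hN a (hTroot a ha); rw [h, mul_zero] at this; exact zero_ne_one this
  have hinv : ∀ a ∈ T, (σ a)⁻¹ = a := fun a ha => (eq_inv_of_mul_eq_one_left (hN a (hTroot a ha))).symm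
  have hC : ∀ a ∈ T, ∃ θ : ℝ, 0 < θ ∧ ∀ y : K, ‖y - a‖ < θ → ‖(σ y)⁻¹ - a‖ < ρ₀ := fun a ha => by
    have hca : ContinuousAt (fun y : K => (σ y)⁻¹) a := (hσ.continuousAt).inv₀ (hσa a ha)
    obtain ⟨θ, hθ, h⟩ := Metric.continuousAt_iff.1 hca ρ₀ hρ₀
    refine ⟨θ, hθ, fun y hy => ?_⟩
    have := h (by rw [dist_eq_norm]; exact hy)
    rw [dist_eq_norm] at this
    rwa [hinv a ha] at this
  choose! θ hθpos hθC using hC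
  obtain ⟨θ₀, hθ₀, -, hθ₀le⟩ := exists_pos_le_forall_of_finset T θ hθpos
  -- §2 with `η := min ρ₀ θ₀`
  obtain ⟨εA, hεA, hA⟩ := exists_forall_root_near p₀ hp₀ (lt_min hρ₀ hθ₀)
  refine ⟨min εA ρ₀, lt_min hεA hρ₀, fun p hp hdeg hcoeff α β hα hβ hαβ => ?_⟩
  -- `α` is near some root `a`
  obtain ⟨a, ha, hαa⟩ := hA p hp hdeg (fun i => (hcoeff i).trans_le (min_le_left _ _)) α hα
  have haT : a ∈ T := Multiset.mem_toFinset.2 ha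
  -- `β = σ(α)⁻¹` is near `a` too
  have hβeq : β = (σ α)⁻¹ := eq_inv_of_mul_eq_one_right hαβ
  have hβa : ‖β - a‖ < ρ₀ := by
    rw [hβeq]
    exact hθC a haT α ((hαa.trans_le (min_le_right _ _)).trans_le (hθ₀le a haT))
  -- two roots near the simple root `a`
  exact hρB a haT p (by omega) (fun i => ((hcoeff i).trans_le (min_le_right _ _)).trans_le (hρ₀le a haT)) α β hα hβ
    ((hαa.trans_le (min_le_left _ _)).trans_le (hρ₀le a haT)) (hβa.trans_le (hρ₀le a haT))

end Core

end Summit.HodgeConjecture.HodgeConjecture.Cruxes.H413.F0P3cStCharTSRootCalculus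

end
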